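import Literature.MathematicalPhysics.QuantumFieldTheory.Balaban1983to89.B4Eq19LatticeOperators
import HarnessLib

/-!
# `UnitScaleGibbsTemporalGaugePrimitive` — THE MARGIN-1 TEMPORAL-GAUGE PRIMITIVE OF A CLOSED, MARGIN-SUPPORTED 2-FORM WITH ZERO COLUMN SUMS
# (the converse of the NET-FLUX ∕ COLUMN-CHARGE constraints; the admissible-test-field constructor of LINE 28 v3's `stub_linTest`; brick (T-PRIM))

Cell `ym3-torus` (YM ladder rung R3 = continuum SU(2) Yang–Mills on every three-torus — a RUNG, NOT d = 4, NOT infinite volume, NOT a mass gap, NOT the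
Clay problem), crux of record `UnitScaleTilt.HistoryTailL` (stmt-QuantumFields-19936); LINE 28 «GrossTransfer» registered on stmt-QuantumFields-23083; width seat
`ym-ust-19936-w5` gen 16, on ★w2-19936 g15's word «GO (Z)» (2026-08-29T20:07:59Z).  ✓`UnitScaleGibbsNormalEquationNetFlux` / ✓`…ColumnCharge` proved the
NECESSARY conditions on the curl `du` of a test field admissible for `stub_linTest` (box-local, margin 1, off the axial comb — hence zero on every
direction-`0` bond): zero net flux per orientation and zero direction-`0` COLUMN SUMS of every `(0,μ)` component.  THIS FILE proves they are SUFFICIENT,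
constructively, on the `ℤ^d` carrier of lit ✓`B4Eq19LatticeOperators` (`Zd d = Fin d → ℤ`, `unitVec`) in the free-symbol letters of ✓`CovariantDischargeLatticeFormsDeg23`
(`(d₁a)(x,μ,ν) = [a(x+e_μ,ν) − a(x,ν)] − [a(x+e_ν,μ) − a(x,μ)]`, alternating `d₂`):

THE TEMPORAL-GAUGE PRIMITIVE.  For an antisymmetric 2-form `r`, the comb direction `0` and a box `[lo, hi]`, put `a(x, 0) := 0` and, for `μ ≠ 0`,
`a(x, μ) := Σ_{k < x₀ − lo₀} r(x[0 ↦ lo₀ + k], 0, μ)` (the partial column sum from the bottom face — the abelian «axial-gauge integral of the curvature»;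
written over `Finset.range ((x₀ − lo₀).toNat)`, so it is `0` below the box).  If `r` is (a) CLOSED (`d₂ r = 0` on every cube), (b) supported on plaquettes
with ALL corners in `[lo + 1, hi − 1]`, and (c) has ZERO direction-`0` column sums (`Σ_{k < hi₀ − lo₀} r(y[0 ↦ lo₀ + k], 0, μ) = 0`, every `μ ≠ 0`, `y`), THEN
* ★ `curl_tprim_eq` — `d₁ a = r` EVERYWHERE (the `(0,μ)` components telescope; the `(μ,ν)` components, `μ,ν ≠ 0`, by closedness
  `∂₀ r_{μν} = ∂_μ r_{0ν} − ∂_ν r_{0μ}` summed along the column, the bottom term vanishing by (b)) — uses (a)(b) only;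
* ★ `tprim_support` — `a(x,μ) ≠ 0 ⇒ μ ≠ 0 ∧ lo + 1 ≤ x ∧ x + e_μ + 1 ≤ hi ∧ lo₀ + 2 ≤ x₀`: EXACTLY the margin-1 support row of `stub_linTest`
  (v2 5d16c6d7 / v3 draft 79e1da6a) read on `ℤ^d`, the OFF-TREE clause `lowPart μ (x − lo) ≠ 0` being implied by `x₀ − lo₀ ≥ 2`, `0 < μ`
  ((b) gives the transverse margins and `x₀ ≥ lo₀ + 2`; (c) kills `a` from the far face `x₀ = hi₀` on);
* `abs_tprim_le`, `sq_tprim_le` — the free bounds `|a(x,μ)| ≤ Σ_k |r(x[0↦lo₀+k],0,μ)|` and `a(x,μ)² ≤ (hi₀ − lo₀)·Σ_k r(…)²` for `x₀ ≤ hi₀`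
  (column Cauchy–Schwarz: summed over a box of side `n` this is `‖a‖₂² ≤ n(n+1)·‖r_{0·}‖₂²`, sharper than (D3♭)'s `d·n^d`; and `‖d₁a‖² = ‖r‖²` verbatim).
So `{d₁a : a margin-1, temporal-gauged} = {r : closed, margin-1-supported, zero 0-column sums}` (⊇ here; ⊆ by (NET-FLUX)/(COL) and `d₂d₁ = 0`): the test
field of the v3 knit is `u_α := a ⊗ iσ_α` with `r := w − σ − δ₃β` (w2-19936 g15 accounting v2), its energy/mass/support rows read off `r`.

HONEST SCOPE.  Elementary lattice calculus on `ℤ^d` (finite telescoping sums); no measure, no gauge field; proves no stub, closes no item.  The push to the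
torus letters (`castSite`, `slotBond`) is the knitter's, via the ✓`CovariantDischargeLatticeFormsBridge`-style dictionaries.  Nothing of `stub_linTest`,
«ShallowFluxSecondMomentL», (Q), 23083/23133/23134, K1 or `HistoryTailL` is proved.  YM₃ on T³ is rung R3 — NOT d = 4, NOT a mass gap, NOT Clay.
References: T. Bałaban, CMP **95** (1984) 17–40 [Balaban1984PropagatorsI] ((1.10) p.19: the axial gauge; (1.4): the plaquette variable of a 1-form);
L. Gross, CMP **92** (1983) 137–162 [GrossCMP1983] (Thm 2.2: exact test 2-forms).
-/

set_option autoImplicit false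

noncomputable section

open scoped BigOperators
open Literature.MathematicalPhysics.QuantumFieldTheory.Balaban1983to89.B4Eq19LatticeOperators (Zd unitVec)

namespace Summit.QuantumFields.YangMills.Theorems.UnitScaleGibbsTemporalGaugePrimitive

variable {d : ℕ}

/-! ## §1 Coordinate bookkeeping on `ℤ^d` -/

/-- `(x + e_μ) κ = x κ + [κ = μ]`. [folklore] -/
theorem add_unitVec_apply (x : Zd d) (μ κ : Fin d) : (x + unitVec μ) κ = x κ + if κ = μ then 1 else 0 := by
  simp only [Pi.add_apply, unitVec, Pi.single_apply]

/-- `(x + e_μ) μ = x μ + 1`. [folklore] -/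
theorem add_unitVec_self (x : Zd d) (μ : Fin d) : (x + unitVec μ) μ = x μ + 1 := by
  rw [add_unitVec_apply, if_pos rfl]

/-- `(x + e_μ) κ = x κ` for `κ ≠ μ`. [folklore] -/
theorem add_unitVec_of_ne (x : Zd d) {μ κ : Fin d} (h : κ ≠ μ) : (x + unitVec μ) κ = x κ := by
  rw [add_unitVec_apply, if_neg h, add_zero]

/-- Overwriting coordinate `i` forgets a step in direction `i`: `(x + e_i)[i ↦ t] = x[i ↦ t]`. [folklore] -/
theorem update_add_unitVec_self (x : Zd d) (i : Fin d) (t : ℤ) :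
    Function.update (x + unitVec i) i t = Function.update x i t := by
  funext κ
  by_cases hκ : κ = i
  · subst hκ; simp
  · rw [Function.update_of_ne hκ, Function.update_of_ne hκ, add_unitVec_of_ne x hκ]

/-- Overwriting coordinate `i` commutes with a step in another direction: `(x + e_μ)[i ↦ t] = x[i ↦ t] + e_μ` (`μ ≠ i`). [folklore] -/
theorem update_add_unitVec_of_ne (x : Zd d) {i μ : Fin d} (h : μ ≠ i) (t : ℤ) :
    Function.update (x + unitVec μ) i t = Function.update x i t + unitVec μ := by
  funext κ
  by_cases hκ : κ = i
  · subst hκ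
    rw [Function.update_self, Pi.add_apply, Function.update_self, unitVec, Pi.single_apply, if_neg (Ne.symm h), add_zero]
  · rw [Function.update_of_ne hκ, Pi.add_apply, Pi.add_apply, Function.update_of_ne hκ]

/-- A step in direction `i` from the column point: `x[i ↦ t] + e_i = x[i ↦ t + 1]`. [folklore] -/
theorem update_add_unitVec_eq_update_succ (x : Zd d) (i : Fin d) (t : ℤ) :
    Function.update x i t + unitVec i = Function.update x i (t + 1) := by
  funext κ
  by_cases hκ : κ = i
  · subst hκ; simp [unitVec]
  · rw [Pi.add_apply, Function.update_of_ne hκ, Function.update_of_ne hκ, unitVec, Pi.single_apply, if_neg hκ, add_zero]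

/-- `x[i ↦ x i] = x`. [folklore] -/
theorem update_eq_self' (x : Zd d) (i : Fin d) : Function.update x i (x i) = x := Function.update_eq_self i x

/-! ## §2 The temporal-gauge primitive: `d₁ a = r` -/

section Primitive

variable (hd : 0 < d) (lo hi : Zd d) (r : Zd d → Fin d → Fin d → ℝ)

/-- ★ **THE `(0, μ)` COMPONENTS TELESCOPE**: with `a(x,0) = 0`, `a(x,μ) = Σ_{k < x₀−lo₀} r(x[0↦lo₀+k],0,μ)` (`μ ≠ 0`), the curl component
`[a(x+e₀,μ) − a(x,μ)] − [a(x+e_μ,0) − a(x,0)]` equals `r(x,0,μ)` — using only that `r(x,0,μ) = 0` below the box (`x₀ ≤ lo₀`). [folklore] -/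
theorem curl_tprim_zero_dir (hmargin : ∀ x μ ν, r x μ ν ≠ 0 → lo + 1 ≤ x ∧ x + unitVec μ + unitVec ν + 1 ≤ hi)
    (x : Zd d) {μ : Fin d} (hμ : μ ≠ ⟨0, hd⟩) :
    ((if μ = ⟨0, hd⟩ then (0 : ℝ) else ∑ k ∈ Finset.range (((x + unitVec ⟨0, hd⟩) ⟨0, hd⟩ - lo ⟨0, hd⟩).toNat),
          r (Function.update (x + unitVec ⟨0, hd⟩) ⟨0, hd⟩ (lo ⟨0, hd⟩ + k)) ⟨0, hd⟩ μ) -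
        (if μ = ⟨0, hd⟩ then (0 : ℝ) else ∑ k ∈ Finset.range ((x ⟨0, hd⟩ - lo ⟨0, hd⟩).toNat),
          r (Function.update x ⟨0, hd⟩ (lo ⟨0, hd⟩ + k)) ⟨0, hd⟩ μ)) -
      ((if (⟨0, hd⟩ : Fin d) = ⟨0, hd⟩ then (0 : ℝ) else ∑ k ∈ Finset.range (((x + unitVec μ) ⟨0, hd⟩ - lo ⟨0, hd⟩).toNat),
          r (Function.update (x + unitVec μ) ⟨0, hd⟩ (lo ⟨0, hd⟩ + k)) ⟨0, hd⟩ ⟨0, hd⟩) -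
        (if (⟨0, hd⟩ : Fin d) = ⟨0, hd⟩ then (0 : ℝ) else ∑ k ∈ Finset.range ((x ⟨0, hd⟩ - lo ⟨0, hd⟩).toNat),
          r (Function.update x ⟨0, hd⟩ (lo ⟨0, hd⟩ + k)) ⟨0, hd⟩ ⟨0, hd⟩)) =
      r x ⟨0, hd⟩ μ := by
  set i0 : Fin d := ⟨0, hd⟩ with hi0
  rw [if_neg hμ, if_neg hμ, if_pos rfl, if_pos rfl, sub_zero, sub_zero, add_unitVec_self]
  simp only [update_add_unitVec_self]
  by_cases hlo : lo i0 ≤ x i0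
  · have hn : (x i0 + 1 - lo i0).toNat = (x i0 - lo i0).toNat + 1 := by omega
    rw [hn, Finset.sum_range_succ]
    have hx : lo i0 + ((x i0 - lo i0).toNat : ℕ) = x i0 := by omega
    rw [hx, update_eq_self']
    ring
  · push Not at hlo
    have h1 : (x i0 + 1 - lo i0).toNat = 0 := by omega
    have h2 : (x i0 - lo i0).toNat = 0 := by omega
    rw [h1, h2, Finset.sum_range_zero, sub_zero]
    by_contra hne
    have h := (hmargin x i0 μ (Ne.symm hne)).1 i0
    simp only [Pi.add_apply, Pi.one_apply] at h
    omega

/-- ★ **THE `(μ, ν)` COMPONENTS, `μ, ν ≠ 0`: closedness summed along the column.**  With `d₂ r = 0` on every cube and the margin, the curl component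
`[a(x+e_μ,ν) − a(x,ν)] − [a(x+e_ν,μ) − a(x,μ)]` of the temporal-gauge primitive equals `r(x,μ,ν)`. [folklore] -/
theorem curl_tprim_transverse
    (hclosed : ∀ x (κ μ ν : Fin d),
      (r (x + unitVec κ) μ ν - r x μ ν) - (r (x + unitVec μ) κ ν - r x κ ν) + (r (x + unitVec ν) κ μ - r x κ μ) = 0)
    (hmargin : ∀ x μ ν, r x μ ν ≠ 0 → lo + 1 ≤ x ∧ x + unitVec μ + unitVec ν + 1 ≤ hi)
    (x : Zd d) {μ ν : Fin d} (hμ : μ ≠ ⟨0, hd⟩) (hν : ν ≠ ⟨0, hd⟩) :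
    ((if ν = ⟨0, hd⟩ then (0 : ℝ) else ∑ k ∈ Finset.range (((x + unitVec μ) ⟨0, hd⟩ - lo ⟨0, hd⟩).toNat),
          r (Function.update (x + unitVec μ) ⟨0, hd⟩ (lo ⟨0, hd⟩ + k)) ⟨0, hd⟩ ν) -
        (if ν = ⟨0, hd⟩ then (0 : ℝ) else ∑ k ∈ Finset.range ((x ⟨0, hd⟩ - lo ⟨0, hd⟩).toNat),
          r (Function.update x ⟨0, hd⟩ (lo ⟨0, hd⟩ + k)) ⟨0, hd⟩ ν)) -
      ((if μ = ⟨0, hd⟩ then (0 : ℝ) else ∑ k ∈ Finset.range (((x + unitVec ν) ⟨0, hd⟩ - lo ⟨0, hd⟩).toNat),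
          r (Function.update (x + unitVec ν) ⟨0, hd⟩ (lo ⟨0, hd⟩ + k)) ⟨0, hd⟩ μ) -
        (if μ = ⟨0, hd⟩ then (0 : ℝ) else ∑ k ∈ Finset.range ((x ⟨0, hd⟩ - lo ⟨0, hd⟩).toNat),
          r (Function.update x ⟨0, hd⟩ (lo ⟨0, hd⟩ + k)) ⟨0, hd⟩ μ)) =
      r x μ ν := by
  set i0 : Fin d := ⟨0, hd⟩ with hi0
  rw [if_neg hμ, if_neg hμ, if_neg hν, if_neg hν, add_unitVec_of_ne x (Ne.symm hμ), add_unitVec_of_ne x (Ne.symm hν)]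
  simp only [update_add_unitVec_of_ne x hμ, update_add_unitVec_of_ne x hν]
  rw [← Finset.sum_sub_distrib, ← Finset.sum_sub_distrib, ← Finset.sum_sub_distrib]
  -- closedness at the cube `(x[0 ↦ lo₀+k]; 0, μ, ν)` turns each summand into a `0`-difference of `r(·, μ, ν)`
  have hsum : ∀ k : ℕ, (r (Function.update x i0 (lo i0 + k) + unitVec μ) i0 ν - r (Function.update x i0 (lo i0 + k)) i0 ν -
      (r (Function.update x i0 (lo i0 + k) + unitVec ν) i0 μ - r (Function.update x i0 (lo i0 + k)) i0 μ)) =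
      r (Function.update x i0 (lo i0 + ((k + 1 : ℕ) : ℤ))) μ ν - r (Function.update x i0 (lo i0 + k)) μ ν := by
    intro k
    have hc := hclosed (Function.update x i0 (lo i0 + k)) i0 μ ν
    rw [update_add_unitVec_eq_update_succ, add_assoc] at hc
    push_cast
    linarith
  simp only [hsum]
  rw [Finset.sum_range_sub (fun k : ℕ => r (Function.update x i0 (lo i0 + (k : ℤ))) μ ν)]
  simp only [Nat.cast_zero, add_zero]
  have h0 : r (Function.update x i0 (lo i0)) μ ν = 0 := by
    by_contra hne
    have h := (hmargin _ μ ν hne).1 i0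
    simp only [Pi.add_apply, Pi.one_apply, Function.update_self] at h
    omega
  rw [h0, sub_zero]
  by_cases hlo : lo i0 ≤ x i0
  · have hx : lo i0 + (((x i0 - lo i0).toNat : ℕ) : ℤ) = x i0 := by omega
    rw [hx, update_eq_self']
  · push Not at hlo
    have h2 : (x i0 - lo i0).toNat = 0 := by omega
    rw [h2, Nat.cast_zero, add_zero, h0]
    by_contra hne
    have h := (hmargin x μ ν (Ne.symm hne)).1 i0
    simp only [Pi.add_apply, Pi.one_apply] at h
    omega

/-- ★★ **`d₁ a = r` EVERYWHERE** for the temporal-gauge primitive of a closed, margin-supported, antisymmetric `r` (all four cases: `(0,μ)`, `(μ,0)`,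
`(μ,ν)` transverse, and the diagonal). [folklore] -/
theorem curl_tprim_eq (hanti : ∀ x μ ν, r x ν μ = -r x μ ν)
    (hclosed : ∀ x (κ μ ν : Fin d),
      (r (x + unitVec κ) μ ν - r x μ ν) - (r (x + unitVec μ) κ ν - r x κ ν) + (r (x + unitVec ν) κ μ - r x κ μ) = 0)
    (hmargin : ∀ x μ ν, r x μ ν ≠ 0 → lo + 1 ≤ x ∧ x + unitVec μ + unitVec ν + 1 ≤ hi)
    (x : Zd d) (μ ν : Fin d) :
    ((if ν = ⟨0, hd⟩ then (0 : ℝ) else ∑ k ∈ Finset.range (((x + unitVec μ) ⟨0, hd⟩ - lo ⟨0, hd⟩).toNat),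
          r (Function.update (x + unitVec μ) ⟨0, hd⟩ (lo ⟨0, hd⟩ + k)) ⟨0, hd⟩ ν) -
        (if ν = ⟨0, hd⟩ then (0 : ℝ) else ∑ k ∈ Finset.range ((x ⟨0, hd⟩ - lo ⟨0, hd⟩).toNat),
          r (Function.update x ⟨0, hd⟩ (lo ⟨0, hd⟩ + k)) ⟨0, hd⟩ ν)) -
      ((if μ = ⟨0, hd⟩ then (0 : ℝ) else ∑ k ∈ Finset.range (((x + unitVec ν) ⟨0, hd⟩ - lo ⟨0, hd⟩).toNat),
          r (Function.update (x + unitVec ν) ⟨0, hd⟩ (lo ⟨0, hd⟩ + k)) ⟨0, hd⟩ μ) -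
        (if μ = ⟨0, hd⟩ then (0 : ℝ) else ∑ k ∈ Finset.range ((x ⟨0, hd⟩ - lo ⟨0, hd⟩).toNat),
          r (Function.update x ⟨0, hd⟩ (lo ⟨0, hd⟩ + k)) ⟨0, hd⟩ μ)) =
      r x μ ν := by
  by_cases hμ : μ = ⟨0, hd⟩
  · subst hμ
    by_cases hν : ν = ⟨0, hd⟩
    · subst hν
      have h0 : r x ⟨0, hd⟩ ⟨0, hd⟩ = 0 := by
        have := hanti x ⟨0, hd⟩ ⟨0, hd⟩; linarith
      rw [h0]; simp
    · exact curl_tprim_zero_dir hd lo hi r hmargin x hν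
  · by_cases hν : ν = ⟨0, hd⟩
    · subst hν
      have h := curl_tprim_zero_dir hd lo hi r hmargin x hμ
      rw [hanti x ⟨0, hd⟩ μ, ← h]
      ring
    · exact curl_tprim_transverse hd lo hi r hclosed hmargin x hμ hν

end Primitive

/-! ## §3 Support (the margin-1 off-tree row) and the free bounds -/

section Support

variable (hd : 0 < d) (lo hi : Zd d) (r : Zd d → Fin d → Fin d → ℝ)

/-- Beyond the far face the partial column sum IS the full column sum: for `hi₀ ≤ x₀` the summands with `lo₀ + k ≥ hi₀ − 1` vanish by the margin. [folklore] -/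
theorem tprim_eq_colSum_of_le (hmargin : ∀ x μ ν, r x μ ν ≠ 0 → lo + 1 ≤ x ∧ x + unitVec μ + unitVec ν + 1 ≤ hi)
    (x : Zd d) (μ : Fin d) (hx : hi ⟨0, hd⟩ ≤ x ⟨0, hd⟩) :
    ∑ k ∈ Finset.range ((x ⟨0, hd⟩ - lo ⟨0, hd⟩).toNat), r (Function.update x ⟨0, hd⟩ (lo ⟨0, hd⟩ + k)) ⟨0, hd⟩ μ =
      ∑ k ∈ Finset.range ((hi ⟨0, hd⟩ - lo ⟨0, hd⟩).toNat), r (Function.update x ⟨0, hd⟩ (lo ⟨0, hd⟩ + k)) ⟨0, hd⟩ μ := by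
  set i0 : Fin d := ⟨0, hd⟩ with hi0
  symm
  refine Finset.sum_subset (fun k hk => Finset.mem_range.2 (lt_of_lt_of_le (Finset.mem_range.1 hk)
    (Int.toNat_le_toNat (sub_le_sub_right hx (lo i0))))) fun k _ hk' => ?_
  rw [Finset.mem_range, not_lt] at hk'
  have hk2 : hi i0 - lo i0 ≤ (k : ℤ) := Int.toNat_le.1 hk'
  by_contra hne
  have h := (hmargin _ i0 μ hne).2 i0
  simp only [Pi.add_apply, Pi.one_apply, Function.update_self, unitVec, Pi.single_apply] at h
  split_ifs at h <;> omega

/-- ★★ **THE SUPPORT ROW**: if the temporal-gauge primitive is nonzero at the bond `⟨x, μ⟩`, then `μ ≠ 0`, `lo + 1 ≤ x`, `x + e_μ + 1 ≤ hi` and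
`lo₀ + 2 ≤ x₀` — the margin-1 row of `stub_linTest` with the off-tree clause (`x₀ − lo₀ ≥ 2 > 0`, `0 < μ`), given the margin of `r` and its zero
column sums. [cite: Balaban1984PropagatorsI, (1.10) p.19] -/
theorem tprim_support (hmargin : ∀ x μ ν, r x μ ν ≠ 0 → lo + 1 ≤ x ∧ x + unitVec μ + unitVec ν + 1 ≤ hi)
    (hcol : ∀ μ : Fin d, μ ≠ ⟨0, hd⟩ → ∀ y : Zd d,
      ∑ k ∈ Finset.range ((hi ⟨0, hd⟩ - lo ⟨0, hd⟩).toNat), r (Function.update y ⟨0, hd⟩ (lo ⟨0, hd⟩ + k)) ⟨0, hd⟩ μ = 0)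
    (x : Zd d) (μ : Fin d)
    (ha : (if μ = ⟨0, hd⟩ then (0 : ℝ) else ∑ k ∈ Finset.range ((x ⟨0, hd⟩ - lo ⟨0, hd⟩).toNat),
      r (Function.update x ⟨0, hd⟩ (lo ⟨0, hd⟩ + k)) ⟨0, hd⟩ μ) ≠ 0) :
    μ ≠ ⟨0, hd⟩ ∧ lo + 1 ≤ x ∧ x + unitVec μ + 1 ≤ hi ∧ lo ⟨0, hd⟩ + 2 ≤ x ⟨0, hd⟩ := by
  set i0 : Fin d := ⟨0, hd⟩ with hi0
  have hμ : μ ≠ i0 := fun h => ha (by rw [if_pos h])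
  rw [if_neg hμ] at ha
  -- some summand is nonzero
  obtain ⟨k, hk, hne⟩ := Finset.exists_ne_zero_of_sum_ne_zero ha
  rw [Finset.mem_range] at hk
  obtain ⟨h1, h2⟩ := hmargin _ i0 μ hne
  -- below the far face (else the sum is the full column sum, which vanishes)
  have hxhi : x i0 < hi i0 := by
    by_contra hge
    push Not at hge
    exact ha (by rw [tprim_eq_colSum_of_le hd lo hi r hmargin x μ hge]; exact hcol μ hμ x)
  have hlo1 := h1 i0
  simp only [Pi.add_apply, Pi.one_apply, Function.update_self] at hlo1
  refine ⟨hμ, fun κ => ?_, fun κ => ?_, by omega⟩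
  · have hk1 := h1 κ
    simp only [Pi.add_apply, Pi.one_apply] at hk1 ⊢
    by_cases hκ : κ = i0
    · subst hκ; rw [Function.update_self] at hk1; omega
    · rw [Function.update_of_ne hκ] at hk1; exact hk1
  · have hk2 := h2 κ
    simp only [Pi.add_apply, Pi.one_apply, unitVec, Pi.single_apply] at hk2 ⊢
    by_cases hκ : κ = i0
    · subst hκ
      rw [Function.update_self, if_pos rfl, if_neg (Ne.symm hμ)] at hk2
      rw [if_neg (Ne.symm hμ)]
      omega
    · rw [Function.update_of_ne hκ, if_neg hκ, add_zero] at hk2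
      exact hk2

/-- **ℓ¹ COLUMN BOUND**: `|a(x,μ)| ≤ Σ_{k < hi₀ − lo₀} |r(x[0↦lo₀+k],0,μ)|` for `x₀ ≤ hi₀` (above the far face `a` is the full column sum anyway). [folklore] -/
theorem abs_tprim_le (x : Zd d) (μ : Fin d) (hx : x ⟨0, hd⟩ ≤ hi ⟨0, hd⟩) :
    |(if μ = ⟨0, hd⟩ then (0 : ℝ) else ∑ k ∈ Finset.range ((x ⟨0, hd⟩ - lo ⟨0, hd⟩).toNat),
        r (Function.update x ⟨0, hd⟩ (lo ⟨0, hd⟩ + k)) ⟨0, hd⟩ μ)| ≤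
      ∑ k ∈ Finset.range ((hi ⟨0, hd⟩ - lo ⟨0, hd⟩).toNat), |r (Function.update x ⟨0, hd⟩ (lo ⟨0, hd⟩ + k)) ⟨0, hd⟩ μ| := by
  split_ifs
  · rw [abs_zero]; exact Finset.sum_nonneg fun _ _ => abs_nonneg _
  · refine (Finset.abs_sum_le_sum_abs _ _).trans ?_
    exact Finset.sum_le_sum_of_subset_of_nonneg (fun k hk => Finset.mem_range.2 (lt_of_lt_of_le (Finset.mem_range.1 hk)
      (Int.toNat_le_toNat (sub_le_sub_right hx (lo ⟨0, hd⟩))))) fun _ _ _ => abs_nonneg _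

/-- **ℓ² COLUMN BOUND (Cauchy–Schwarz)**: `a(x,μ)² ≤ (hi₀ − lo₀)·Σ_{k < hi₀ − lo₀} r(x[0↦lo₀+k],0,μ)²` for `lo₀ ≤ hi₀`, `x₀ ≤ hi₀`: summed over a box of
`n + 1` sites per direction this is `‖a‖₂² ≤ n(n+1)·‖r_{0·}‖₂²`, the Poincaré constant of the temporal gauge. [folklore] -/
theorem sq_tprim_le (x : Zd d) (μ : Fin d) (hlo : lo ⟨0, hd⟩ ≤ hi ⟨0, hd⟩) (hx : x ⟨0, hd⟩ ≤ hi ⟨0, hd⟩) :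
    (if μ = ⟨0, hd⟩ then (0 : ℝ) else ∑ k ∈ Finset.range ((x ⟨0, hd⟩ - lo ⟨0, hd⟩).toNat),
        r (Function.update x ⟨0, hd⟩ (lo ⟨0, hd⟩ + k)) ⟨0, hd⟩ μ) ^ 2 ≤
      ((hi ⟨0, hd⟩ - lo ⟨0, hd⟩ : ℤ) : ℝ) *
        ∑ k ∈ Finset.range ((hi ⟨0, hd⟩ - lo ⟨0, hd⟩).toNat), r (Function.update x ⟨0, hd⟩ (lo ⟨0, hd⟩ + k)) ⟨0, hd⟩ μ ^ 2 := by
  have habs := abs_tprim_le hd lo hi r x μ hx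
  have hcs : (∑ k ∈ Finset.range ((hi ⟨0, hd⟩ - lo ⟨0, hd⟩).toNat), |r (Function.update x ⟨0, hd⟩ (lo ⟨0, hd⟩ + k)) ⟨0, hd⟩ μ|) ^ 2 ≤
      (Finset.range ((hi ⟨0, hd⟩ - lo ⟨0, hd⟩).toNat)).card *
        ∑ k ∈ Finset.range ((hi ⟨0, hd⟩ - lo ⟨0, hd⟩).toNat), |r (Function.update x ⟨0, hd⟩ (lo ⟨0, hd⟩ + k)) ⟨0, hd⟩ μ| ^ 2 :=
    sq_sum_le_card_mul_sum_sq
  have hcard : ((Finset.range ((hi ⟨0, hd⟩ - lo ⟨0, hd⟩).toNat)).card : ℝ) = ((hi ⟨0, hd⟩ - lo ⟨0, hd⟩ : ℤ) : ℝ) := by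
    rw [Finset.card_range]
    have : (((hi ⟨0, hd⟩ - lo ⟨0, hd⟩).toNat : ℕ) : ℤ) = hi ⟨0, hd⟩ - lo ⟨0, hd⟩ := Int.toNat_of_nonneg (sub_nonneg.mpr hlo)
    exact_mod_cast this
  simp only [sq_abs] at hcs
  rw [hcard] at hcs
  calc _ = |(if μ = ⟨0, hd⟩ then (0 : ℝ) else ∑ k ∈ Finset.range ((x ⟨0, hd⟩ - lo ⟨0, hd⟩).toNat),
              r (Function.update x ⟨0, hd⟩ (lo ⟨0, hd⟩ + k)) ⟨0, hd⟩ μ)| ^ 2 := (sq_abs _).symm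
    _ ≤ (∑ k ∈ Finset.range ((hi ⟨0, hd⟩ - lo ⟨0, hd⟩).toNat), |r (Function.update x ⟨0, hd⟩ (lo ⟨0, hd⟩ + k)) ⟨0, hd⟩ μ|) ^ 2 :=
        pow_le_pow_left₀ (abs_nonneg _) habs 2
    _ ≤ _ := hcs

end Support

/-! ## §4 Packaged: existence of an admissible primitive -/

/-- ★★★ **(T-PRIM) PACKAGED.**  For an antisymmetric, CLOSED 2-form `r` on `ℤ^d` supported on plaquettes with all corners in `[lo + 1, hi − 1]` and with
ZERO direction-`0` column sums, there is a 1-form `a` with: `d₁ a = r` everywhere; `a` vanishes on every direction-`0` bond (temporal gauge); and the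
MARGIN-1 OFF-TREE SUPPORT ROW `a(x,μ) ≠ 0 → lo + 1 ≤ x ∧ x + e_μ + 1 ≤ hi ∧ lo₀ + 2 ≤ x₀` (the `stub_linTest` row on `ℤ^d`).  The witness is the
temporal-gauge primitive of §2–§3, whose column bounds `abs_tprim_le` / `sq_tprim_le` apply. [cite: Balaban1984PropagatorsI, (1.10) p.19] -/
theorem exists_temporalGauge_primitive (hd : 0 < d) (lo hi : Zd d) (r : Zd d → Fin d → Fin d → ℝ)
    (hanti : ∀ x μ ν, r x ν μ = -r x μ ν)
    (hclosed : ∀ x (κ μ ν : Fin d),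
      (r (x + unitVec κ) μ ν - r x μ ν) - (r (x + unitVec μ) κ ν - r x κ ν) + (r (x + unitVec ν) κ μ - r x κ μ) = 0)
    (hmargin : ∀ x μ ν, r x μ ν ≠ 0 → lo + 1 ≤ x ∧ x + unitVec μ + unitVec ν + 1 ≤ hi)
    (hcol : ∀ μ : Fin d, μ ≠ ⟨0, hd⟩ → ∀ y : Zd d,
      ∑ k ∈ Finset.range ((hi ⟨0, hd⟩ - lo ⟨0, hd⟩).toNat), r (Function.update y ⟨0, hd⟩ (lo ⟨0, hd⟩ + k)) ⟨0, hd⟩ μ = 0) :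
    ∃ a : Zd d → Fin d → ℝ,
      (∀ x μ ν, (a (x + unitVec μ) ν - a x ν) - (a (x + unitVec ν) μ - a x μ) = r x μ ν) ∧
      (∀ x, a x ⟨0, hd⟩ = 0) ∧
      (∀ x μ, a x μ ≠ 0 → μ ≠ ⟨0, hd⟩ ∧ lo + 1 ≤ x ∧ x + unitVec μ + 1 ≤ hi ∧ lo ⟨0, hd⟩ + 2 ≤ x ⟨0, hd⟩) ∧
      (∀ x μ, x ⟨0, hd⟩ ≤ hi ⟨0, hd⟩ →
        |a x μ| ≤ ∑ k ∈ Finset.range ((hi ⟨0, hd⟩ - lo ⟨0, hd⟩).toNat), |r (Function.update x ⟨0, hd⟩ (lo ⟨0, hd⟩ + k)) ⟨0, hd⟩ μ|) := by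
  refine ⟨fun x μ => if μ = ⟨0, hd⟩ then (0 : ℝ) else ∑ k ∈ Finset.range ((x ⟨0, hd⟩ - lo ⟨0, hd⟩).toNat),
      r (Function.update x ⟨0, hd⟩ (lo ⟨0, hd⟩ + k)) ⟨0, hd⟩ μ, ?_, ?_, ?_, ?_⟩
  · intro x μ ν
    exact curl_tprim_eq hd lo hi r hanti hclosed hmargin x μ ν
  · intro x
    exact if_pos rfl
  · intro x μ ha
    exact tprim_support hd lo hi r hmargin hcol x μ ha
  · intro x μ hx
    exact abs_tprim_le hd lo hi r x μ hx

end Summit.QuantumFields.YangMills.Theorems.UnitScaleGibbsTemporalGaugePrimitive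

end
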